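import Mathlib
import HarnessLib
import Literature.Analysis.Complex.WeierstrassPreparation
import Summits.RiemannHypothesis.RiemannHypothesis.Theorems.PfPersistenceFfDialPrefix

/-!
# Function-field mirror: the dial line is AFFINE through window `2g - 1`
(pub-rhpf, seat ffmirror-2; HONEST FRAMING: mechanism/rigidity campaign — no RH claims)

Companion to `PfPersistenceFfAngleTwin` / `PfPersistenceFfDialPrefix`.  For a monic integer polynomial
`h` of degree `2g` and the ONE-COEFFICIENT DIAL `h_c = h + c·x^g` (`c ∈ ℤ`; in `L`-polynomial terms
`P(T) ↦ P(T) + c T^g`, pub-rhpf-ffmirror-1 `FF-FAKES.md` L1), the blind-prefix lemma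
(`weilWindowForm_dial`) says the window forms `T_M(q, h_c)`, `M ≤ g - 1`, do not depend on `c`.
Here we record the next range: by Newton's identities the power sum `s_k` is ISOBARIC of weight `k`
in the elementary symmetric functions, so `e_g` (the only one the dial moves) enters `s_k` LINEARLY
as long as `k ≤ 2g - 1`; hence for `M ≤ 2g - 1` the map `c ↦ T_M(q, h_c)` is AFFINE.  We prove the
midpoint form, which is all the cell uses:

* `weilWindowForm_dial_midpoint`: if `a + b = 2c` then
  `T_M(q, h_a) + T_M(q, h_b) = 2 • T_M(q, h_c)` for every `M` with `M + 1 ≤ 2g`.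

Use in the cell (pub-rhpf-ffmirror-2 `SEPARATION.md` §12, DATA there, not formalised here): in the
served function-field census 129 of the 143 RH-satisfying NON-realizable Weil polynomials `h` have
BOTH lattice neighbours `h ± x^g` realizable (by a curve or an abelian variety); by this lemma every
informative window form (`M ≤ 2g - 1`; from `M = 2g` on the forms of RH data are singular) of such an
`h` is the midpoint of the corresponding forms of two genuine objects, so no reader whose acceptance
region in form space is convex (eigenvalue floors, PSD or linear-inequality tests) rejects it while
accepting its two genuine neighbours.  Pure algebra, [folklore]; Newton's identities in the multiset
form `Literature.Analysis.Complex.SCV.natCast_mul_esymm_eq_sum`.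
-/

set_option linter.dupNamespace false  -- the mandated namespace repeats `RiemannHypothesis`

noncomputable section

open Polynomial Finset

namespace Summit.RiemannHypothesis.RiemannHypothesis.Theorems.PfPersistence.FfAngleTwin

/-! ## Newton, midpoint form -/

/-- NEWTON (multiset form, midpoint version): let `Ap, Am, Az` be multisets whose elementary symmetric
functions agree for `1 ≤ k ≤ m`, `k ≠ g`, and satisfy `e_g(Ap) + e_g(Am) = 2 e_g(Az)`.  If
`m + 1 ≤ 2g` then `s_k(Ap) + s_k(Am) = 2 s_k(Az)` for `1 ≤ k ≤ m` (strong induction on `k` through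
`k e_k = (-1)^{k+1} Σ_{i<k} (-1)^i e_i s_{k-i}`: the only term containing `e_g` is `e_g s_{k-g}`, and
`s_{k-g}` with `k - g ≤ g - 1` is common to the three multisets by the blind prefix). [folklore] -/
theorem powerSum_midpoint {Ap Am Az : Multiset ℂ} {g m : ℕ} (hmg : m + 1 ≤ 2 * g)
    (hep : ∀ k, 1 ≤ k → k ≤ m → k ≠ g → Ap.esymm k = Az.esymm k)
    (hem : ∀ k, 1 ≤ k → k ≤ m → k ≠ g → Am.esymm k = Az.esymm k)
    (heg : Ap.esymm g + Am.esymm g = 2 * Az.esymm g) :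
    ∀ k, 1 ≤ k → k ≤ m → powerSum Ap k + powerSum Am k = 2 * powerSum Az k := by
  -- the blind prefix: below `g` the power sums of the three multisets coincide
  have hprep : ∀ j, 1 ≤ j → j + 1 ≤ g → j ≤ m → powerSum Ap j = powerSum Az j := by
    intro j hj1 hjg hjm
    refine powerSum_eq_of_esymm_eq (m := min (g - 1) m) ?_ j hj1 (le_min (by omega) hjm)
    intro k hk1 hk
    exact hep k hk1 (le_trans hk (min_le_right _ _))
      (by have := le_trans hk (min_le_left _ _); omega)
  have hprem : ∀ j, 1 ≤ j → j + 1 ≤ g → j ≤ m → powerSum Am j = powerSum Az j := by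
    intro j hj1 hjg hjm
    refine powerSum_eq_of_esymm_eq (m := min (g - 1) m) ?_ j hj1 (le_min (by omega) hjm)
    intro k hk1 hk
    exact hem k hk1 (le_trans hk (min_le_right _ _))
      (by have := le_trans hk (min_le_left _ _); omega)
  intro k
  induction k using Nat.strong_induction_on with
  | _ k ih =>
    intro hk1 hkm
    have Np := Literature.Analysis.Complex.SCV.natCast_mul_esymm_eq_sum Ap k
    have Nm := Literature.Analysis.Complex.SCV.natCast_mul_esymm_eq_sum Am k
    have N0 := Literature.Analysis.Complex.SCV.natCast_mul_esymm_eq_sum Az k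
    -- the top terms: `k (e_k⁺ + e_k⁻) = 2 k e_k⁰`
    have htop : (k : ℂ) * Ap.esymm k + (k : ℂ) * Am.esymm k = 2 * ((k : ℂ) * Az.esymm k) := by
      by_cases hkg : k = g
      · subst hkg; rw [← mul_add, heg]; ring
      · rw [hep k hk1 hkm hkg, hem k hk1 hkm hkg]; ring
    rw [Np, Nm, N0] at htop
    have hmem : ((0 : ℕ), k) ∈ (antidiagonal k).filter (fun a => a.1 < k) := by
      simp only [mem_filter, HasAntidiagonal.mem_antidiagonal]; omega
    -- the remaining terms agree termwise in the midpoint sense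
    have hrest :
        ∑ a ∈ ((antidiagonal k).filter (fun a => a.1 < k)).erase (0, k),
            (-1) ^ a.1 * Ap.esymm a.1 * (Ap.map (· ^ a.2)).sum
          + ∑ a ∈ ((antidiagonal k).filter (fun a => a.1 < k)).erase (0, k),
            (-1) ^ a.1 * Am.esymm a.1 * (Am.map (· ^ a.2)).sum
          = 2 * ∑ a ∈ ((antidiagonal k).filter (fun a => a.1 < k)).erase (0, k),
            (-1) ^ a.1 * Az.esymm a.1 * (Az.map (· ^ a.2)).sum := by
      rw [← sum_add_distrib, mul_sum]
      refine sum_congr rfl (fun a ha => ?_)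
      have ha' := ha
      rw [mem_erase, mem_filter, HasAntidiagonal.mem_antidiagonal] at ha'
      obtain ⟨hne, hak, hlt⟩ := ha'
      have ha1 : 1 ≤ a.1 := by
        rcases Nat.eq_zero_or_pos a.1 with h0 | h0
        · exact absurd (Prod.ext h0 (by simpa [h0] using hak)) hne
        · exact h0
      have ha2 : 1 ≤ a.2 := by omega
      by_cases hig : a.1 = g
      · -- the `e_g · s_{k-g}` term: `s_{k-g}` is common (blind prefix)
        have hp := hprep a.2 ha2 (by omega) (by omega)
        have hm := hprem a.2 ha2 (by omega) (by omega)
        simp only [powerSum] at hp hm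
        rw [hp, hm, hig]
        calc (-1) ^ g * Ap.esymm g * (Az.map (· ^ a.2)).sum
              + (-1) ^ g * Am.esymm g * (Az.map (· ^ a.2)).sum
            = (-1) ^ g * (Ap.esymm g + Am.esymm g) * (Az.map (· ^ a.2)).sum := by ring
          _ = 2 * ((-1) ^ g * Az.esymm g * (Az.map (· ^ a.2)).sum) := by rw [heg]; ring
      · have e1 := hep a.1 ha1 (by omega) hig
        have e2 := hem a.1 ha1 (by omega) hig
        have hs := ih a.2 (by omega) ha2 (by omega)
        simp only [powerSum] at hs
        rw [e1, e2]
        calc (-1) ^ a.1 * Az.esymm a.1 * (Ap.map (· ^ a.2)).sum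
              + (-1) ^ a.1 * Az.esymm a.1 * (Am.map (· ^ a.2)).sum
            = (-1) ^ a.1 * Az.esymm a.1
                * ((Ap.map (· ^ a.2)).sum + (Am.map (· ^ a.2)).sum) := by ring
          _ = 2 * ((-1) ^ a.1 * Az.esymm a.1 * (Az.map (· ^ a.2)).sum) := by rw [hs]; ring
    rw [← add_sum_erase _ _ hmem, ← add_sum_erase _ _ hmem, ← add_sum_erase _ _ hmem] at htop
    rw [multiset_esymm_zero, multiset_esymm_zero, multiset_esymm_zero] at htop
    simp only [pow_zero, one_mul] at htop
    have hu : ((-1 : ℂ) ^ (k + 1)) ≠ 0 := pow_ne_zero _ (neg_ne_zero.mpr one_ne_zero)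
    have h2 : (-1 : ℂ) ^ (k + 1) *
        (((Ap.map (· ^ k)).sum
          + ∑ a ∈ ((antidiagonal k).filter (fun a => a.1 < k)).erase (0, k),
              (-1) ^ a.1 * Ap.esymm a.1 * (Ap.map (· ^ a.2)).sum)
        + ((Am.map (· ^ k)).sum
          + ∑ a ∈ ((antidiagonal k).filter (fun a => a.1 < k)).erase (0, k),
              (-1) ^ a.1 * Am.esymm a.1 * (Am.map (· ^ a.2)).sum))
        = (-1 : ℂ) ^ (k + 1) * (2 * ((Az.map (· ^ k)).sum
          + ∑ a ∈ ((antidiagonal k).filter (fun a => a.1 < k)).erase (0, k),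
              (-1) ^ a.1 * Az.esymm a.1 * (Az.map (· ^ a.2)).sum)) := by
      rw [mul_add]; rw [htop]; ring
    have h3 := mul_left_cancel₀ hu h2
    simp only [powerSum]
    linear_combination h3 - hrest

/-! ## Vieta, coefficientwise -/

/-- For a monic complex polynomial of degree `n` and `k ≤ n`: `e_k(roots) = (-1)^k · coeff (n - k)`.
[folklore] -/
theorem esymm_roots_eq_coeff {p : ℂ[X]} (hp : p.Monic) {k : ℕ} (hk : k ≤ p.natDegree) :
    p.roots.esymm k = (-1) ^ k * p.coeff (p.natDegree - k) := by
  have hr : Multiset.card p.roots = p.natDegree := (IsAlgClosed.splits p).natDegree_eq_card_roots.symm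
  have h1 := Polynomial.coeff_eq_esymm_roots_of_card hr (k := p.natDegree - k) (Nat.sub_le _ _)
  rw [hp.leadingCoeff, Nat.sub_sub_self hk, one_mul] at h1
  rw [h1, ← mul_assoc, ← pow_add, ← two_mul, pow_mul]
  simp

/-- Beyond the degree the elementary symmetric functions of the roots vanish. [folklore] -/
theorem esymm_roots_eq_zero {p : ℂ[X]} {k : ℕ} (hk : p.natDegree < k) : p.roots.esymm k = 0 := by
  have hr : Multiset.card p.roots = p.natDegree := (IsAlgClosed.splits p).natDegree_eq_card_roots.symm
  rw [Multiset.esymm, Multiset.powersetCard_eq_empty k (by rw [hr]; exact hk)]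
  simp

/-! ## The dial line `c ↦ h + c x^g` -/

/-- Coefficients of the dialled polynomial over `ℂ`: only the coefficient of `x^g` moves, by `c`.
[folklore] -/
theorem coeff_map_dial (h : ℤ[X]) (g : ℕ) (c : ℤ) (j : ℕ) :
    ((h + C c * X ^ g).map (Int.castRingHom ℂ)).coeff j
      = (h.map (Int.castRingHom ℂ)).coeff j + if j = g then (c : ℂ) else 0 := by
  rw [Polynomial.map_add, coeff_add, Polynomial.map_mul, Polynomial.map_C, Polynomial.map_pow,
    Polynomial.map_X, coeff_C_mul_X_pow]
  simp

/-- Elementary symmetric functions along the dial: for `k ≠ g` they do not depend on `c`. [folklore] -/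
theorem esymm_frobRoots_dial_of_ne {h : ℤ[X]} {g : ℕ} (hh : h.Monic) (hdeg : h.natDegree = 2 * g)
    (hg : 1 ≤ g) (c : ℤ) {k : ℕ} (hkg : k ≠ g) :
    (frobRoots (h + C c * X ^ g)).esymm k = (frobRoots h).esymm k := by
  obtain ⟨hmon, hdeg'⟩ := monic_dial hh hdeg hg c
  have hp : ((h + C c * X ^ g).map (Int.castRingHom ℂ)).Monic := hmon.map _
  have hp0 : (h.map (Int.castRingHom ℂ)).Monic := hh.map _
  have hdp : ((h + C c * X ^ g).map (Int.castRingHom ℂ)).natDegree = 2 * g := by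
    rw [hmon.natDegree_map, hdeg']
  have hdp0 : (h.map (Int.castRingHom ℂ)).natDegree = 2 * g := by rw [hh.natDegree_map, hdeg]
  unfold frobRoots
  by_cases hk : k ≤ 2 * g
  · rw [esymm_roots_eq_coeff hp (by rw [hdp]; exact hk), esymm_roots_eq_coeff hp0 (by rw [hdp0]; exact hk),
      hdp, hdp0, coeff_map_dial, if_neg (by omega), add_zero]
  · rw [esymm_roots_eq_zero (by rw [hdp]; omega), esymm_roots_eq_zero (by rw [hdp0]; omega)]

/-- … and `e_g` moves affinely: `e_g(h_c) = e_g(h) + (-1)^g c`. [folklore] -/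
theorem esymm_frobRoots_dial_g {h : ℤ[X]} {g : ℕ} (hh : h.Monic) (hdeg : h.natDegree = 2 * g)
    (hg : 1 ≤ g) (c : ℤ) :
    (frobRoots (h + C c * X ^ g)).esymm g = (frobRoots h).esymm g + (-1) ^ g * (c : ℂ) := by
  obtain ⟨hmon, hdeg'⟩ := monic_dial hh hdeg hg c
  have hp : ((h + C c * X ^ g).map (Int.castRingHom ℂ)).Monic := hmon.map _
  have hp0 : (h.map (Int.castRingHom ℂ)).Monic := hh.map _
  have hdp : ((h + C c * X ^ g).map (Int.castRingHom ℂ)).natDegree = 2 * g := by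
    rw [hmon.natDegree_map, hdeg']
  have hdp0 : (h.map (Int.castRingHom ℂ)).natDegree = 2 * g := by rw [hh.natDegree_map, hdeg]
  unfold frobRoots
  rw [esymm_roots_eq_coeff hp (by rw [hdp]; omega), esymm_roots_eq_coeff hp0 (by rw [hdp0]; omega),
    hdp, hdp0, coeff_map_dial, show 2 * g - g = g by omega, if_pos rfl, mul_add]

/-- THE DIAL LINE IS AFFINE THROUGH WINDOW `2g - 1` (midpoint form): for `h` monic of degree `2g`,
`g ≥ 1`, integers `a + b = 2c`, and every `M` with `M + 1 ≤ 2g`,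
`T_M(q, h + a x^g) + T_M(q, h + b x^g) = 2 • T_M(q, h + c x^g)`. [folklore] -/
theorem weilWindowForm_dial_midpoint (q : ℝ) {h : ℤ[X]} {g : ℕ} (hh : h.Monic)
    (hdeg : h.natDegree = 2 * g) (hg : 1 ≤ g) {a b c : ℤ} (habc : a + b = 2 * c)
    {M : ℕ} (hM : M + 1 ≤ 2 * g) :
    weilWindowForm q (h + C a * X ^ g) M + weilWindowForm q (h + C b * X ^ g) M
      = (2 : ℂ) • weilWindowForm q (h + C c * X ^ g) M := by
  have hps : ∀ k, 1 ≤ k → k ≤ M →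
      powerSum (frobRoots (h + C a * X ^ g)) k + powerSum (frobRoots (h + C b * X ^ g)) k
        = 2 * powerSum (frobRoots (h + C c * X ^ g)) k := by
    refine powerSum_midpoint (g := g) (m := M) hM ?_ ?_ ?_
    · intro k _ _ hkg
      rw [esymm_frobRoots_dial_of_ne hh hdeg hg a hkg, esymm_frobRoots_dial_of_ne hh hdeg hg c hkg]
    · intro k _ _ hkg
      rw [esymm_frobRoots_dial_of_ne hh hdeg hg b hkg, esymm_frobRoots_dial_of_ne hh hdeg hg c hkg]
    · rw [esymm_frobRoots_dial_g hh hdeg hg a, esymm_frobRoots_dial_g hh hdeg hg b,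
        esymm_frobRoots_dial_g hh hdeg hg c]
      have habc' : (a : ℂ) + (b : ℂ) = 2 * (c : ℂ) := by exact_mod_cast habc
      linear_combination ((-1 : ℂ) ^ g) * habc'
  have hcard : ∀ d : ℤ, Multiset.card (frobRoots (h + C d * X ^ g)) = 2 * g := fun d => by
    obtain ⟨hmon, hdeg'⟩ := monic_dial hh hdeg hg d
    rw [card_frobRoots hmon, hdeg']
  ext i j
  simp only [weilWindowForm, ffWindowForm, Matrix.add_apply, Matrix.smul_apply, Matrix.of_apply,
    smul_eq_mul]
  rw [ffKernel_eq, ffKernel_eq, ffKernel_eq]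
  rcases Nat.eq_zero_or_pos (Nat.dist i j) with h0 | h0
  · rw [h0, powerSum_zero, powerSum_zero, powerSum_zero, hcard a, hcard b, hcard c]; ring
  · have hk := hps (Nat.dist i j) h0 (natDist_le_of_fin i j)
    rw [← add_div, hk]; ring

/-- Special case used in the cell (lattice neighbours): for `M + 1 ≤ 2g`,
`T_M(q, h + x^g) + T_M(q, h - x^g) = 2 • T_M(q, h)`. [folklore] -/
theorem weilWindowForm_neighbours_midpoint (q : ℝ) {h : ℤ[X]} {g : ℕ} (hh : h.Monic)
    (hdeg : h.natDegree = 2 * g) (hg : 1 ≤ g) {M : ℕ} (hM : M + 1 ≤ 2 * g) :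
    weilWindowForm q (h + X ^ g) M + weilWindowForm q (h - X ^ g) M
      = (2 : ℂ) • weilWindowForm q h M := by
  have h1 : h + X ^ g = h + C (1 : ℤ) * X ^ g := by simp
  have h2 : h - X ^ g = h + C (-1 : ℤ) * X ^ g := by simp [sub_eq_add_neg]
  have h3 : h = h + C (0 : ℤ) * X ^ g := by simp
  rw [h1, h2]
  conv_rhs => rw [h3]
  exact weilWindowForm_dial_midpoint q hh hdeg hg (a := 1) (b := -1) (c := 0) (by norm_num) hM

end Summit.RiemannHypothesis.RiemannHypothesis.Theorems.PfPersistence.FfAngleTwin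

end
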